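import Summits.BirchSwinnertonDyer.BirchSwinnertonDyer.Theorems.ResidualThetaTransportAtTwoResidualLayerAscends
import Summits.BirchSwinnertonDyer.BirchSwinnertonDyer.Theorems.ResidualThetaTransportAtTwoThetaTransportResidualCharpoly
import Literature.NumberTheory.EllipticCurves.GreenbergSelmerDualDataExistsProofs
import HarnessLib

/-!
# Residual control for the cofree module of the θ-line: `j_* : H¹(ℚ_∞, ((W[2^∞])[2])^f) ⥲ H¹(ℚ_∞, A_g)[ϖ]`
# along the residual isomorphism `j : ((W[2^∞])[2])^f ≅ A_g[ϖ]` (crux (R≥)ᵖ, stub `stub_transport` v2, step (d))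

Route `ResidualThetaTransportAtTwo` (RTT), crux (R≥)ᵖ `ResidualThetaCountLowerPureAtTwo` (stmt-BirchSwinnertonDyer-26074),
line «bt26-lambda» v2; seat `prover-bsd-wall-rtt-p2` g12 (`--supports`, closes nothing). HONEST FRAMING: THEOREMS ONLY (no
definition, no named fact, no instance, no `sorry`); nothing about local conditions or any Selmer count; BSD is not proved
by any of this.

WHAT. `stub_transport` v2 receives the residual isomorphism as data: `j : ((W[2^∞])[2])^f →+ A_g` injective,
`Γ_ℚ`-equivariant, `range j = A_g[ϖ]` (`A_g = GreenbergSelmer.Cofree ρ E`, `E = ℚ₂(ι K_g)`, `𝒪` its integers, `ϖ` a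
uniformiser). Step (d) of the line is the cohomology sequence of `0 → A_g[ϖ] → A_g →^{ϖ} A_g → 0` over `ℚ_∞`:
* §1 (generic: topological group `G`, subgroup `H`, discrete `G`-modules `N ↪ M` along an equivariant injection `i`, a scalar
  `r` of a semiring acting on `M` and commuting with `G`): `mem_range_pushH1_of_scalarH1_eq_zero` — if `i(N) ⊇ M[r]`, `r·M = M`
  and orbit maps are continuous, every class `c` with `scalarH1 r c = 0` is in the image of `i_*` (the `r`-twin of the tree's
  `SignedTransportAtTwo.mem_range_pushH1_of_nsmul_eq_zero`); `scalarH1_pushH1_eq_zero_of_forall` — `scalarH1 r ∘ i_* = 0` when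
  `r` kills `i(N)`.
* §2 (`𝒪 = padicCoeffIntegers S`): `norm_lt_one_of_irreducible`, `exists_pow_smul_cofree_eq_zero_of_irreducible` (`A` is
  `ϖ^∞`-torsion), `cofree_divisible` (`ϖ·A = A`).
* §3 **`pushH1_residual_injective`, `mem_range_pushH1_residual_iff`** — on the habitat (`GoodSS W 2`, any `ℤ₂`-extension `κ`):
  `j_* : H¹(Γ_{ℚ_∞}, ((W[2^∞])[2])^f) → H¹(Γ_{ℚ_∞}, A_g)` is injective with image `{y | scalarH1 ϖ y = 0}`; the input
  `A_g^{Γ_{ℚ_∞}} = 0` (`forall_smul_eq_imp_eq_zero_cofree`) comes from `W[2]^{Γ_{ℚ_∞}} = 0` (g9, p613876) through `j`.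

References: [GreenbergVatsal2000] p. 3 and Prop. (2.8); [BDKim2009] Prop. 2.10; [SerreGaloisCohomology1997] I.§2.2, I.§5.1;
[EmertonPollackWeston2006] §3.1, Thm. 3.1.1 (`Sel(ℚ_∞, A_f)[π]`).
-/

set_option autoImplicit false
-- the Theorems namespace of this sub repeats the summit name by design (D-0017 nested layout)
set_option linter.dupNamespace false

noncomputable section

open scoped AddSubgroup
open WeierstrassCurve NumberField Field Literature Literature.NumberTheory.EllipticCurves
  Literature.NumberTheory.EllipticCurves.GreenbergSelmer Literature.NumberTheory.EllipticCurves.GreenbergVatsal2000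
  Literature.NumberTheory.EllipticCurves.Rank1Residual Literature.NumberTheory.GaloisRepresentations
  Summit.BirchSwinnertonDyer.BirchSwinnertonDyer.Theorems.SignedTransportAtTwo

namespace Summit.BirchSwinnertonDyer.BirchSwinnertonDyer.Theorems.ThetaTransport

universe u

/-! ### §1. The `r`-torsion Kummer sequence for continuous `H¹` of discrete modules -/

section Generic

variable {G : Type u} [Group G] [TopologicalSpace G] [IsTopologicalGroup G] (H : Subgroup G)
variable {M : Type u} [AddCommGroup M] [DistribMulAction G M] [TopologicalSpace M] [DiscreteTopology M]
variable {N : Type u} [AddCommGroup N] [DistribMulAction G N] [TopologicalSpace N] [DiscreteTopology N]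
variable {R : Type*} [Semiring R] [Module R M] [SMulCommClass G R M]
variable (i : N →+ M) (hi : ∀ (g : G) (x : N), i (g • x) = g • i x)

/-- **`scalarH1 r ∘ i_* = 0` when `r` kills `i(N)`** (on cocycles: `r • (i ∘ φ) = 0`). [cite: SerreGaloisCohomology1997, I.§2.2] -/
theorem scalarH1_pushH1_eq_zero_of_forall (r : R) (hr : ∀ x : N, r • i x = 0) (c : subgroupH1 H N) :
    scalarH1 H M r (resH1Hom (ContinuousMonoidHom.id H) i (fun h x ↦ hi h x) c) = 0 := by
  obtain ⟨φ, rfl⟩ := oneCocycleClass_surjective _ c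
  rw [SignedTransportAtTwo.resH1Hom_id_oneCocycleClass, scalarH1_oneCocycleClass, ← oneCocycleClass_zero]
  congr 1
  apply Subtype.ext
  ext h
  rw [contOneCocycles.pullback_apply, contOneCocycles.pullback_apply]
  exact hr _

/-- **Every class `c` of `H¹(H, M)` with `scalarH1 r c = 0` comes from `H¹(H, N)` when `i(N) ⊇ M[r]` and `r·M = M`** (orbit maps
continuous): if `r[φ] = 0` then `r φ = ∂m`, `m = r m'`, and `φ − ∂m'` is a continuous cocycle with values in `M[r] ⊆ i(N)` — the
surjectivity half of `H¹(H, M[r]) ≅ H¹(H, M)[r]` from `0 → M[r] → M →ʳ M → 0`; the `r`-twin of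
`SignedTransportAtTwo.mem_range_pushH1_of_nsmul_eq_zero`. [cite: SerreGaloisCohomology1997, I.§2.2 and I.§5.1] -/
theorem mem_range_pushH1_of_scalarH1_eq_zero (r : R) (hinj : Function.Injective i)
    (hrange : ∀ m : M, r • m = 0 → m ∈ Set.range i) (hdiv : ∀ m : M, ∃ m' : M, r • m' = m)
    (hcont : ∀ m : M, Continuous fun g : G ↦ g • m)
    {c : subgroupH1 H M} (hc : scalarH1 H M r c = 0) :
    c ∈ (resH1Hom (ContinuousMonoidHom.id H) i (fun h x ↦ hi h x)).range := by
  obtain ⟨φ, rfl⟩ := oneCocycleClass_surjective _ c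
  -- `r φ` is principal
  rw [scalarH1_oneCocycleClass, oneCocycleClass_eq_zero_iff] at hc
  obtain ⟨m, hm⟩ := hc
  obtain ⟨m', rfl⟩ := hdiv m
  have hm' : ∀ h : H, r • φ.1 h = (h : G) • (r • m') - r • m' := fun h ↦ by
    have := hm h
    rw [contOneCocycles.pullback_apply] at this
    exact this
  -- the corrected cocycle `ψ = φ - ∂m'` takes values in `M[r] ⊆ i(N)`
  let ψM : H → M := fun h ↦ φ.1 h - ((h : G) • m' - m')
  have hψM : ∀ h, r • ψM h = 0 := fun h ↦ by
    change r • (φ.1 h - ((h : G) • m' - m')) = 0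
    rw [smul_sub, hm' h, smul_sub, ← smul_comm (h : G) r m']
    exact sub_self _
  have hψmem : ∀ h, ψM h ∈ Set.range i := fun h ↦ hrange _ (hψM h)
  choose ψN hψN using hψmem
  have hψMcont : Continuous ψM :=
    φ.1.continuous.sub (((hcont m').comp continuous_subtype_val).sub continuous_const)
  have hψNcont : Continuous ψN := by
    refine continuous_discrete_rng.mpr fun n ↦ ?_
    have hset : ψN ⁻¹' {n} = ψM ⁻¹' {i n} := by
      ext h
      simp only [Set.mem_preimage, Set.mem_singleton_iff]
      constructor
      · intro h1; rw [← hψN h, h1]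
      · intro h1; exact hinj (by rw [hψN h, h1])
    rw [hset]
    exact (isOpen_discrete _).preimage hψMcont
  -- `ψN` is a cocycle of `N` (checked after applying the injective `i`)
  have hψNcoc : (⟨ψN, hψNcont⟩ : C(H, N)) ∈ contOneCocycles (discreteTopRep H N) := by
    intro g h
    apply hinj
    change i (ψN (g * h)) = i (ψN g + g • ψN h)
    rw [map_add, Subgroup.smul_def, hi, hψN, hψN, hψN]
    change φ.1 (g * h) - ((((g * h : H) : G) • m') - m') =
      φ.1 g - ((g : G) • m' - m') + (g : G) • (φ.1 h - ((h : G) • m' - m'))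
    have hφ : φ.1 (g * h) = φ.1 g + g • φ.1 h := φ.2 g h
    rw [hφ, Subgroup.smul_def, Subgroup.coe_mul, mul_smul, smul_sub, smul_sub]
    abel
  refine ⟨oneCocycleClass _ ⟨⟨ψN, hψNcont⟩, hψNcoc⟩, ?_⟩
  rw [SignedTransportAtTwo.resH1Hom_id_oneCocycleClass, ← sub_eq_zero, ← oneCocycleClass_sub, oneCocycleClass_eq_zero_iff]
  refine ⟨-m', fun g ↦ ?_⟩
  change i (ψN g) - φ.1 g = g • (-m') - (-m')
  rw [hψN, Subgroup.smul_def]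
  change φ.1 g - ((g : G) • m' - m') - φ.1 g = (g : G) • (-m') - (-m')
  rw [smul_neg]
  abel

end Generic

/-! ### §2. `A = E²/𝒪²` is `ϖ^∞`-torsion and `ϖ`-divisible -/

section Cofree

variable {S : Set (PadicAlgCl 2)} {G : Type} [Group G] [TopologicalSpace G]

/-- A non-unit of `𝒪 = padicCoeffIntegers S` has norm `< 1` (an element of norm `1` is inverted inside `ℚ₂(S)` by an element
of norm `1`). [cite: NeukirchANT1999, Ch. II (4.8)] -/
theorem norm_lt_one_of_not_isUnit {x : ↥(padicCoeffIntegers S)} (hx : ¬ IsUnit x) : ‖(x : PadicAlgCl 2)‖ < 1 := by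
  refine lt_of_le_of_ne x.2.2 fun h1 ↦ hx ?_
  have hx0 : (x : PadicAlgCl 2) ≠ 0 := fun h0 ↦ by rw [h0, norm_zero] at h1; exact zero_ne_one h1
  have hinv : (x : PadicAlgCl 2)⁻¹ ∈ padicCoeffIntegers S :=
    ⟨inv_mem x.2.1, by rw [norm_inv, h1, inv_one]⟩
  exact isUnit_iff_exists_inv.mpr ⟨⟨_, hinv⟩, Subtype.ext (mul_inv_cancel₀ hx0)⟩

/-- **`A = E²/𝒪²` is `ϖ^∞`-torsion** for a non-unit `ϖ`: `ϖ^N a = 0` for `N ≫ 0` (`‖ϖ‖ < 1`, so `ϖ^N v ∈ 𝒪²`).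
[cite: Greenberg1989, §1 p. 98] -/
theorem exists_pow_smul_cofree_eq_zero_of_not_isUnit {n : ℕ} (ρ : FramedRep G ↥(padicCoeffIntegers S) n)
    {ϖ : ↥(padicCoeffIntegers S)} (hϖ : ¬ IsUnit ϖ) (a : Cofree ρ ↥(padicCoeffField S)) :
    ∃ N : ℕ, ϖ ^ N • a = 0 := by
  obtain ⟨v, rfl⟩ := cofreeMk_surjective _ ρ a
  have hlt := norm_lt_one_of_not_isUnit hϖ
  -- a uniform exponent for the finitely many coordinates
  have hcoord : ∀ i : Fin n, ∃ N : ℕ, ∀ N' ≥ N, ‖(ϖ : PadicAlgCl 2)‖ ^ N' * ‖((v i : ↥(padicCoeffField S)) : PadicAlgCl 2)‖ ≤ 1 := by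
    intro i
    obtain ⟨N, hN⟩ := exists_pow_lt_of_lt_one (show (0 : ℝ) < 1 / (‖((v i : ↥(padicCoeffField S)) : PadicAlgCl 2)‖ + 1) by positivity) hlt
    refine ⟨N, fun N' hN' ↦ ?_⟩
    have hle : ‖(ϖ : PadicAlgCl 2)‖ ^ N' ≤ ‖(ϖ : PadicAlgCl 2)‖ ^ N :=
      pow_le_pow_of_le_one (norm_nonneg _) hlt.le hN'
    have hpos : 0 ≤ ‖((v i : ↥(padicCoeffField S)) : PadicAlgCl 2)‖ := norm_nonneg _
    calc ‖(ϖ : PadicAlgCl 2)‖ ^ N' * ‖((v i : ↥(padicCoeffField S)) : PadicAlgCl 2)‖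
        ≤ (1 / (‖((v i : ↥(padicCoeffField S)) : PadicAlgCl 2)‖ + 1)) * ‖((v i : ↥(padicCoeffField S)) : PadicAlgCl 2)‖ :=
          mul_le_mul_of_nonneg_right (hle.trans hN.le) hpos
      _ ≤ 1 := by
          rw [div_mul_eq_mul_div, one_mul, div_le_one (by positivity)]
          linarith
  choose Nc hNc using hcoord
  refine ⟨Finset.univ.sup Nc, ?_⟩
  rw [← map_smul, ← LinearMap.mem_ker, ker_cofreeMk, mem_lattice_iff]
  refine ⟨fun i ↦ ⟨((ϖ ^ Finset.univ.sup Nc • v) i : ↥(padicCoeffField S)),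
    ⟨((ϖ ^ Finset.univ.sup Nc • v) i).2, ?_⟩⟩, funext fun i ↦ rfl⟩
  rw [Pi.smul_apply, Algebra.smul_def, map_pow]
  change ‖((ϖ : PadicAlgCl 2) ^ Finset.univ.sup Nc * ((v i : ↥(padicCoeffField S)) : PadicAlgCl 2))‖ ≤ 1
  rw [norm_mul, norm_pow]
  exact hNc i _ (Finset.le_sup (Finset.mem_univ i))

/-- **`A = E²/𝒪²` is `ϖ`-divisible** for `ϖ ≠ 0`: `a = ϖ • (ϖ⁻¹ v mod 𝒪²)`. [cite: Greenberg1989, §1 p. 98] -/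
theorem cofree_divisible {n : ℕ} (ρ : FramedRep G ↥(padicCoeffIntegers S) n) {ϖ : ↥(padicCoeffIntegers S)}
    (hϖ0 : ϖ ≠ 0) (a : Cofree ρ ↥(padicCoeffField S)) : ∃ a' : Cofree ρ ↥(padicCoeffField S), ϖ • a' = a := by
  obtain ⟨v, rfl⟩ := cofreeMk_surjective _ ρ a
  have hϖE : (algebraMap ↥(padicCoeffIntegers S) ↥(padicCoeffField S) ϖ : ↥(padicCoeffField S)) ≠ 0 := fun h ↦
    hϖ0 (Subtype.ext (by
      have := congrArg (fun y : ↥(padicCoeffField S) ↦ (y : PadicAlgCl 2)) h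
      exact this))
  refine ⟨cofreeMk _ ρ ((algebraMap ↥(padicCoeffIntegers S) ↥(padicCoeffField S) ϖ)⁻¹ • v), ?_⟩
  rw [← map_smul, ← IsScalarTower.algebraMap_smul ↥(padicCoeffField S) ϖ, smul_smul, mul_inv_cancel₀ hϖE, one_smul]

end Cofree

/-! ### §3. `j_* : H¹(Γ_{ℚ_∞}, ((W[2^∞])[2])^f) ⥲ H¹(Γ_{ℚ_∞}, A_g)[ϖ]` on the habitat -/

section Habitat

variable (W : WeierstrassCurve ℚ) [W.IsElliptic] [W.IsGloballyMinimal] {M : ℕ}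
  {g : CuspForm (CongruenceSubgroup.Gamma0 M) 2} {ι : ModularForms.coeffField g →+* PadicAlgCl 2}

/-- **`A_g^{Γ_{ℚ_∞}} = 0` on the habitat**: a `Γ_{ℚ_∞}`-fixed `a ≠ 0` has a `ϖ`-power multiple `b ≠ 0` with `ϖ b = 0`, still fixed;
`b = j x` with `x ∈ (((W[2^∞])[2])^f)^{Γ_{ℚ_∞}} = 0` (`ResidualLayer.eq_zero_of_forall_kerSubgroup_smul_eq`, p613876).
[cite: GreenbergLNM1716, §1 p. 62] [cite: EmertonPollackWeston2006, §3.1] -/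
theorem forall_smul_eq_imp_eq_zero_cofree (hss : GoodSS W 2) (κ : ZpExtension ℚ 2)
    (ρ : FramedGaloisRep ℚ ↥(padicCoeffIntegers (Set.range ι)) 2) {ϖ : ↥(padicCoeffIntegers (Set.range ι))}
    (hϖ : Irreducible ϖ) {f : ℕ}
    (j : (Fin f → ↥(AddSubgroup.torsionBy ↥(W.geomPrimaryTorsion 2) (2 : ℤ))) →+ Cofree ρ ↥(padicCoeffField (Set.range ι)))
    (hjinj : Function.Injective j)
    (hjsmul : ∀ (σ : absoluteGaloisGroup ℚ) (x : Fin f → ↥(AddSubgroup.torsionBy ↥(W.geomPrimaryTorsion 2) (2 : ℤ))),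
      j (σ • x) = σ • j x)
    (hjrange : Set.range j = {a | ϖ • a = 0})
    (a : Cofree ρ ↥(padicCoeffField (Set.range ι))) (ha : ∀ σ ∈ κ.kerSubgroup, σ • a = a) : a = 0 := by
  classical
  by_contra hne
  obtain ⟨N, hN⟩ := exists_pow_smul_cofree_eq_zero_of_not_isUnit ρ hϖ.not_isUnit a
  -- the least `N` with `ϖ^N a = 0` is positive; `b = ϖ^(N-1) a ≠ 0` is killed by `ϖ` and fixed
  have hex : ∃ N : ℕ, ϖ ^ N • a = 0 := ⟨N, hN⟩
  set N₀ := Nat.find hex with hN₀def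
  have hN₀ : ϖ ^ N₀ • a = 0 := Nat.find_spec hex
  have hN₀pos : 0 < N₀ := by
    rcases Nat.eq_zero_or_pos N₀ with h | h
    · rw [h, pow_zero, one_smul] at hN₀; exact absurd hN₀ hne
    · exact h
  set b := ϖ ^ (N₀ - 1) • a with hbdef
  have hb0 : b ≠ 0 := Nat.find_min hex (Nat.sub_lt hN₀pos Nat.one_pos)
  have hbϖ : ϖ • b = 0 := by
    rw [hbdef, smul_smul, ← pow_succ', Nat.sub_add_cancel hN₀pos]; exact hN₀
  have hbfix : ∀ σ ∈ κ.kerSubgroup, σ • b = b := fun σ hσ ↦ by rw [hbdef, smul_comm, ha σ hσ]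
  -- `b = j x` with `x` fixed, hence `x = 0`
  obtain ⟨x, hx⟩ : b ∈ Set.range j := by rw [hjrange]; exact hbϖ
  have hxfix : ∀ σ ∈ κ.kerSubgroup, σ • x = x := fun σ hσ ↦ hjinj (by rw [hjsmul, hx]; exact hbfix σ hσ)
  apply hb0
  have hx0 : x = 0 := funext fun i ↦
    ResidualLayer.eq_zero_of_forall_kerSubgroup_smul_eq W hss κ (x i) fun σ hσ ↦ by
      have := congr_fun (hxfix σ hσ) i
      rwa [Pi.smul_apply] at this
  rw [← hx, hx0, map_zero]

/-- **`j_* : H¹(Γ_{ℚ_∞}, ((W[2^∞])[2])^f) → H¹(Γ_{ℚ_∞}, A_g)` is injective** on the habitat (`A_g^{Γ_{ℚ_∞}} = 0`: a point all of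
whose `h • m − m` are `ϖ`-torsion has `ϖ m` fixed, hence `0`). [cite: GreenbergVatsal2000, p. 3 (proof of Thm. (1.4))]
[cite: BDKim2009, Prop. 2.10] -/
theorem pushH1_residual_injective (hss : GoodSS W 2) (κ : ZpExtension ℚ 2)
    (ρ : FramedGaloisRep ℚ ↥(padicCoeffIntegers (Set.range ι)) 2) {ϖ : ↥(padicCoeffIntegers (Set.range ι))}
    (hϖ : Irreducible ϖ) {f : ℕ}
    (j : (Fin f → ↥(AddSubgroup.torsionBy ↥(W.geomPrimaryTorsion 2) (2 : ℤ))) →+ Cofree ρ ↥(padicCoeffField (Set.range ι)))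
    (hjinj : Function.Injective j)
    (hjsmul : ∀ (σ : absoluteGaloisGroup ℚ) (x : Fin f → ↥(AddSubgroup.torsionBy ↥(W.geomPrimaryTorsion 2) (2 : ℤ))),
      j (σ • x) = σ • j x)
    (hjrange : Set.range j = {a | ϖ • a = 0}) :
    Function.Injective (pushH1 κ.kerSubgroup j hjsmul) := by
  refine pushH1_injective_of_saturated j (fun (h : κ.kerSubgroup) x ↦ hjsmul h x) hjinj fun m hm ↦ ?_
  rw [hjrange, Set.mem_setOf_eq]
  refine forall_smul_eq_imp_eq_zero_cofree W hss κ ρ hϖ j hjinj hjsmul hjrange _ fun σ hσ ↦ ?_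
  obtain ⟨x, hx⟩ := hm ⟨σ, hσ⟩
  have hx0 : ϖ • j x = 0 := by
    have : j x ∈ Set.range j := ⟨x, rfl⟩
    rw [hjrange] at this
    exact this
  rw [smul_comm, ← sub_eq_zero, ← smul_sub]
  change ϖ • ((⟨σ, hσ⟩ : κ.kerSubgroup) • m - m) = 0
  rw [← hx, hx0]

omit [W.IsElliptic] [W.IsGloballyMinimal] in
/-- **The image of `j_*` is exactly `H¹(Γ_{ℚ_∞}, A_g)[ϖ] = {y | scalarH1 ϖ y = 0}`** (`A_g` is `ϖ`-divisible with open stabilisers,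
`j` maps onto `A_g[ϖ]`). [cite: GreenbergVatsal2000, p. 3 and Prop. (2.8)] [cite: BDKim2009, Prop. 2.10]
[cite: EmertonPollackWeston2006, Thm. 3.1.1] -/
theorem mem_range_pushH1_residual_iff (κ : ZpExtension ℚ 2)
    (ρ : FramedGaloisRep ℚ ↥(padicCoeffIntegers (Set.range ι)) 2) {ϖ : ↥(padicCoeffIntegers (Set.range ι))}
    (hϖ : Irreducible ϖ) {f : ℕ}
    (j : (Fin f → ↥(AddSubgroup.torsionBy ↥(W.geomPrimaryTorsion 2) (2 : ℤ))) →+ Cofree ρ ↥(padicCoeffField (Set.range ι)))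
    (hjinj : Function.Injective j)
    (hjsmul : ∀ (σ : absoluteGaloisGroup ℚ) (x : Fin f → ↥(AddSubgroup.torsionBy ↥(W.geomPrimaryTorsion 2) (2 : ℤ))),
      j (σ • x) = σ • j x)
    (hjrange : Set.range j = {a | ϖ • a = 0})
    (y : subgroupH1 κ.kerSubgroup (Cofree ρ ↥(padicCoeffField (Set.range ι)))) :
    y ∈ (pushH1 κ.kerSubgroup j hjsmul).range ↔
      scalarH1 κ.kerSubgroup (Cofree ρ ↥(padicCoeffField (Set.range ι))) ϖ y = 0 := by
  constructor
  · rintro ⟨c, rfl⟩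
    refine scalarH1_pushH1_eq_zero_of_forall κ.kerSubgroup j hjsmul ϖ (fun x ↦ ?_) c
    have : j x ∈ Set.range j := ⟨x, rfl⟩
    rw [hjrange] at this
    exact this
  · intro hy
    refine mem_range_pushH1_of_scalarH1_eq_zero κ.kerSubgroup j hjsmul ϖ hjinj (fun m hm ↦ ?_)
      (cofree_divisible ρ hϖ.ne_zero) (fun m ↦ ?_) hy
    · rw [hjrange]; exact hm
    · exact continuous_smul_const_of_isOpen_stabilizer m (isOpen_stabilizer_cofree (Set.range ι) ρ m)

end Habitat

end Summit.BirchSwinnertonDyer.BirchSwinnertonDyer.Theorems.ThetaTransport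

end
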